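import Summits.BirchSwinnertonDyer.BirchSwinnertonDyer.Theorems.ManinLocalTwoThreeCuspCoeffAsymptotics
import Summits.BirchSwinnertonDyer.BirchSwinnertonDyer.Theorems.ManinLocalTwoThreeNewformPinningFortyEight
import HarnessLib

/-!
# Level 60 (`4 ∣ 60`, genus `7`), part 1: seven explicit old forms of `S₂(Γ₀(60))` and their first seven `q`-coefficients

Cell bsd-f2-manin, route `ManinLocalTwoThree` (crux C2 `ManinOddAtFour`, stmt-22967: `2² ∣ 60`), prover seat p2 gen 27.  `X₀(60)` has genus
`7` and NO newform: `S₂(Γ₀(60))` is spanned by the images of `S₂(Γ₀(15)) = ℂf₁₅`, `S₂(Γ₀(20)) = ℂf₂₀` and `S₂(Γ₀(30))` (there is no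
elliptic curve of conductor `60`).  This file prepares seven explicit OLD forms, all images of `η`-PRODUCT cusp forms under degeneracy
maps (`f ↦ d·f(dτ)`), and computes their first seven Fourier coefficients (p2 g27's `cuspCoeff_eq_coeff_of_tendsto`):

  `F₁ = f₁₅ = η₁η₃η₅η₁₅`, `F₂ = ι₂f₁₅ = 2f₁₅(2τ)`, `F₃ = ι₄f₁₅ = 4f₁₅(4τ)`, `F₄ = f₂₀ = η₂²η₁₀²`, `F₅ = ι₃f₂₀ = 3f₂₀(3τ)`,
  `F₆ = b₃₀ = η₃η₅η₆η₁₀ ∈ S₂(Γ₀(30))`, `F₇ = ι₂b₃₀ = 2b₃₀(2τ)`;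

  coefficient rows (`n = 1..7`): `(1,−1,−1,−1,1,1,0)`, `(0,2,0,−2,0,−2,0)`, `(0,0,0,4,0,0,0)`, `(1,0,−2,0,−1,0,2)`, `(0,0,3,0,0,0,0)`,
  `(1,0,0,−1,0,−1,−2)`, `(0,2,0,0,0,0,0)` — an invertible `7 × 7` matrix.

* §1 `q(dτ) = q^d`, `E_δ(dτ) = E_{dδ}(τ)` at the point `diag(d,1)·τ`; `f₁₅ = qE₁E₃E₅E₁₅`, `b₃₀ = qE₃E₅E₆E₁₀` (Euler forms).
* §2 The seven functions modulo `o(q⁷)` and the coefficient table.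

The sequel `…NoNewformSixty` concludes: the seven forms are independent, `S₂(Γ₀(60))^{old} = S₂(Γ₀(60))` (`dim = g = 7`), `S₂(Γ₀(60))^{new} = 0`,
no `X₀(60)`-datum exists, C2 at `N = 60` holds vacuously.  No definition, no named fact, no sorry.  Nothing here proves C2 for all `N`,
Manin's conjecture or BSD. [cite: DiamondShurman2005, §5.6] [cite: CremonaAlgorithms1997, Table 3 (N = 15, 20, 30, 60)]
-/

set_option autoImplicit false
-- lint-debt: the directory name repeats the summit name (sibling precedent `ManinLocalTwoThreeNewformPinningFortyEight.lean`)
set_option linter.dupNamespace false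

noncomputable section

open Complex Filter Topology Set Function Asymptotics Polynomial
open UpperHalfPlane hiding I
open scoped Real Topology Manifold MatrixGroups ModularForm
open ModularForm CongruenceSubgroup Matrix.SpecialLinearGroup
open Literature.NumberTheory.ModularForms
open Literature.NumberTheory.EllipticCurves Literature.NumberTheory.EllipticCurves.ModularForms

namespace Summit.BirchSwinnertonDyer.BirchSwinnertonDyer.Theorems.ManinLocalTwoThree.NoNewformSixty

open CuspToolkit QRemainder EulerRemainders CuspCoeffAsymptotics

/-! ## §1 Values at `diag(d, 1)·τ` and the Euler forms of `f₁₅`, `b₃₀` -/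

/-- `q(d·τ) = q(τ)^d` at the point `diag(d,1)·τ ∈ ℍ`. [folklore] -/
theorem qParam_tpD (d : ℕ) [NeZero d] (τ : ℍ) :
    Function.Periodic.qParam 1 ((tpD d • τ : ℍ) : ℂ) = Function.Periodic.qParam 1 (τ : ℂ) ^ d := by
  rw [coe_tpD_smul, qParam_one_natCast_mul]

/-- `E_δ(d·τ) = E_{dδ}(τ)`. [folklore] -/
theorem eulerFn_tpD (d δ : ℕ) [NeZero d] (τ : ℍ) : eulerFn δ (tpD d • τ) = eulerFn (d * δ) τ := by
  unfold eulerFn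
  rw [coe_tpD_smul, qParam_one_natCast_mul, ← pow_mul]

/-- Value of a degeneracy image in weight `2`: `(ι_d f)(τ) = d · f(d·τ)`. [cite: DiamondShurman2005, §5.6] -/
theorem degeneracyMap0_apply {M L : ℕ} [NeZero M] [NeZero L] (d : ℕ) [NeZero d] (h : M * d ∣ L) (f : CuspForm (Gamma0 M) 2) (τ : ℍ) :
    degeneracyMap0 M L d 2 f τ = (d : ℂ) * f (tpD d • τ) := by
  rw [congr_fun (coe_degeneracyMap0 M L d 2 h f) τ, slash_tpD_apply]
  norm_num

/-- **`f₁₅ = η₁η₃η₅η₁₅ = qE₁E₃E₅E₁₅`.** [folklore] -/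
theorem f15_eq (τ : ℍ) :
    cuspFormEta15 τ = Function.Periodic.qParam 1 (τ : ℂ) * eulerFn 1 τ * eulerFn 3 τ * eulerFn 5 τ * eulerFn 15 τ := by
  rw [show (cuspFormEta15 τ : ℂ) = etaQuotient 15 (expFn etaList15) τ from rfl, etaQuotient_eq_cexp_mul_prod,
    show Nat.divisors 15 = {1, 3, 5, 15} by decide]
  have hsum : (∑ δ ∈ ({1, 3, 5, 15} : Finset ℕ), (δ : ℤ) * expFn etaList15 δ) = ((24 * 1 : ℕ) : ℤ) := by decide
  rw [hsum, EulerRemaindersSixtyFour.cexp_eq_qParam_pow, pow_one]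
  rw [Finset.prod_insert (by decide), Finset.prod_insert (by decide), Finset.prod_insert (by decide), Finset.prod_singleton]
  rw [show expFn etaList15 1 = 1 by decide, show expFn etaList15 3 = 1 by decide, show expFn etaList15 5 = 1 by decide,
    show expFn etaList15 15 = 1 by decide]
  simp only [zpow_one]
  ring

/-- Ligozat/Newman certificate of `b₃₀ = η₃η₅η₆η₁₀ ∈ S₂(Γ₀(30))` (the tree's `etaCertsThirty`, first entry). [cite: Ligozat1975, Ch. 3] -/
theorem etaCert_b30 : EtaCert 30 [(3, 1), (5, 1), (6, 1), (10, 1)] 30 := by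
  decide

/-- **`b₃₀ = η₃η₅η₆η₁₀ ∈ S₂(Γ₀(30))`** (as a term). [cite: Ligozat1975, Ch. 3] -/
theorem exists_cuspForm_b30 : ∃ B : CuspForm (Gamma0 30) 2, ⇑B = etaQuotient 30 (expFn [(3, 1), (5, 1), (6, 1), (10, 1)]) :=
  ⟨etaQuotientCuspForm 30 _ 2 (by decide) (newmanCond_of_etaCert etaCert_b30) etaCert_b30.2.2.2.2, rfl⟩

/-- **`b₃₀ = qE₃E₅E₆E₁₀`.** [folklore] -/
theorem b30_eq (τ : ℍ) :
    etaQuotient 30 (expFn [(3, 1), (5, 1), (6, 1), (10, 1)]) τ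
      = Function.Periodic.qParam 1 (τ : ℂ) * eulerFn 3 τ * eulerFn 5 τ * eulerFn 6 τ * eulerFn 10 τ := by
  rw [etaQuotient_eq_cexp_mul_prod, show Nat.divisors 30 = {1, 2, 3, 5, 6, 10, 15, 30} by decide]
  have hsum : (∑ δ ∈ ({1, 2, 3, 5, 6, 10, 15, 30} : Finset ℕ), (δ : ℤ) * expFn [(3, 1), (5, 1), (6, 1), (10, 1)] δ) = ((24 * 1 : ℕ) : ℤ) := by
    decide
  rw [hsum, EulerRemaindersSixtyFour.cexp_eq_qParam_pow, pow_one]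
  rw [Finset.prod_insert (by decide), Finset.prod_insert (by decide), Finset.prod_insert (by decide), Finset.prod_insert (by decide),
    Finset.prod_insert (by decide), Finset.prod_insert (by decide), Finset.prod_insert (by decide), Finset.prod_singleton]
  rw [show expFn [(3, 1), (5, 1), (6, 1), (10, 1)] 1 = 0 by decide, show expFn [(3, 1), (5, 1), (6, 1), (10, 1)] 2 = 0 by decide,
    show expFn [(3, 1), (5, 1), (6, 1), (10, 1)] 3 = 1 by decide, show expFn [(3, 1), (5, 1), (6, 1), (10, 1)] 5 = 1 by decide,
    show expFn [(3, 1), (5, 1), (6, 1), (10, 1)] 6 = 1 by decide, show expFn [(3, 1), (5, 1), (6, 1), (10, 1)] 10 = 1 by decide,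
    show expFn [(3, 1), (5, 1), (6, 1), (10, 1)] 15 = 0 by decide, show expFn [(3, 1), (5, 1), (6, 1), (10, 1)] 30 = 0 by decide]
  simp only [zpow_one, zpow_zero]
  ring

/-! ## §2 The seven old forms modulo `o(q⁷)` and their coefficients -/

/-- The Euler truncations used below, all modulo `o(q⁷)`. [folklore] -/
theorem euler_truncations :
    Tendsto (fun τ : ℍ ↦ (eulerFn 1 τ - (1 - X - X ^ 2 + X ^ 5 + X ^ 7 : ℂ[X]).eval (Function.Periodic.qParam 1 (τ : ℂ)))
      / Function.Periodic.qParam 1 (τ : ℂ) ^ 7) atImInfty (𝓝 0) ∧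
    Tendsto (fun τ : ℍ ↦ (eulerFn 2 τ - (1 - X ^ 2 - X ^ 4 : ℂ[X]).eval (Function.Periodic.qParam 1 (τ : ℂ)))
      / Function.Periodic.qParam 1 (τ : ℂ) ^ 7) atImInfty (𝓝 0) ∧
    Tendsto (fun τ : ℍ ↦ (eulerFn 3 τ - (1 - X ^ 3 - X ^ 6 : ℂ[X]).eval (Function.Periodic.qParam 1 (τ : ℂ)))
      / Function.Periodic.qParam 1 (τ : ℂ) ^ 7) atImInfty (𝓝 0) ∧
    Tendsto (fun τ : ℍ ↦ (eulerFn 4 τ - (1 - X ^ 4 - X ^ 8 : ℂ[X]).eval (Function.Periodic.qParam 1 (τ : ℂ)))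
      / Function.Periodic.qParam 1 (τ : ℂ) ^ 7) atImInfty (𝓝 0) ∧
    Tendsto (fun τ : ℍ ↦ (eulerFn 5 τ - (1 - X ^ 5 : ℂ[X]).eval (Function.Periodic.qParam 1 (τ : ℂ)))
      / Function.Periodic.qParam 1 (τ : ℂ) ^ 7) atImInfty (𝓝 0) ∧
    Tendsto (fun τ : ℍ ↦ (eulerFn 6 τ - (1 - X ^ 6 : ℂ[X]).eval (Function.Periodic.qParam 1 (τ : ℂ)))
      / Function.Periodic.qParam 1 (τ : ℂ) ^ 7) atImInfty (𝓝 0) :=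
  ⟨EulerRemaindersTwenty.tendsto_mono (by norm_num) EulerRemaindersForty.tendsto_eulerFn_one_nine,
    EulerRemaindersTwenty.tendsto_mono (by norm_num) EulerRemaindersFortyEight.tendsto_eulerFn_two_nine,
    EulerRemaindersTwenty.tendsto_mono (by norm_num) tendsto_eulerFn_three,
    EulerRemaindersTwenty.tendsto_mono (by norm_num) EulerRemaindersFortyEight.tendsto_eulerFn_four_nine,
    EulerRemaindersTwenty.tendsto_mono (by norm_num) EulerRemaindersForty.tendsto_eulerFn_five_nine,
    EulerRemaindersTwenty.tendsto_mono (by norm_num) EulerRemaindersFortyEight.tendsto_eulerFn_six_nine⟩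

/-- **`F₁ = f₁₅ = q − q² − q³ − q⁴ + q⁵ + q⁶ + 0·q⁷ + o(q⁷)`** (as `ι₁f₁₅` at level `60`). [cite: CremonaAlgorithms1997, Table 3 (15a)] -/
theorem tendsto_F1 :
    Tendsto (fun τ : ℍ ↦ (degeneracyMap0 15 60 1 2 cuspFormEta15 τ - (X - X ^ 2 - X ^ 3 - X ^ 4 + X ^ 5 + X ^ 6 : ℂ[X]).eval
      (Function.Periodic.qParam 1 (τ : ℂ))) / Function.Periodic.qParam 1 (τ : ℂ) ^ 7) atImInfty (𝓝 0) := by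
  obtain ⟨hE1, -, hE3, -, hE5, -⟩ := euler_truncations
  have hE15 := tendsto_eulerFn (δ := 15) (m := 7) (by norm_num)
  have hG := QRemainder.reduce (X - X ^ 2 - X ^ 3 - X ^ 4 + X ^ 5 + X ^ 6)
    (3 + X - X ^ 2 - 3 * X ^ 3 - 2 * X ^ 5 - X ^ 6 + X ^ 8 + X ^ 9 + X ^ 11 : ℂ[X]) (by ring)
    (QRemainder.qParam_pow_mul 1 (QRemainder.mul (QRemainder.mul (QRemainder.mul hE1 hE3) hE5) hE15))
  refine hG.congr fun τ ↦ ?_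
  rw [congr_fun (coe_degeneracyMap0_one 15 60 2 (by norm_num) cuspFormEta15) τ, f15_eq]
  ring

/-- **`F₂ = ι₂f₁₅ = 2f₁₅(2τ) = 2q² − 2q⁴ − 2q⁶ + o(q⁷)`.** [cite: DiamondShurman2005, §5.6] -/
theorem tendsto_F2 :
    Tendsto (fun τ : ℍ ↦ (degeneracyMap0 15 60 2 2 cuspFormEta15 τ - (2 * X ^ 2 - 2 * X ^ 4 - 2 * X ^ 6 : ℂ[X]).eval
      (Function.Periodic.qParam 1 (τ : ℂ))) / Function.Periodic.qParam 1 (τ : ℂ) ^ 7) atImInfty (𝓝 0) := by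
  obtain ⟨-, hE2, -, -, -, hE6⟩ := euler_truncations
  have hE10 := tendsto_eulerFn (δ := 10) (m := 7) (by norm_num)
  have hE30 := tendsto_eulerFn (δ := 30) (m := 7) (by norm_num)
  have hG := QRemainder.reduce (2 * X ^ 2 - 2 * X ^ 4 - 2 * X ^ 6) (-2 + 2 * X ^ 2 + 2 * X ^ 4 : ℂ[X]) (by simp only [map_ofNat]; ring)
    (QRemainder.const_mul 2 (QRemainder.qParam_pow_mul 2 (QRemainder.mul (QRemainder.mul (QRemainder.mul hE2 hE6) hE10) hE30)))
  refine hG.congr fun τ ↦ ?_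
  rw [degeneracyMap0_apply 2 (by norm_num) cuspFormEta15, f15_eq, qParam_tpD, eulerFn_tpD, eulerFn_tpD, eulerFn_tpD, eulerFn_tpD]
  norm_num
  ring

/-- **`F₃ = ι₄f₁₅ = 4f₁₅(4τ) = 4q⁴ + o(q⁷)`.** [cite: DiamondShurman2005, §5.6] -/
theorem tendsto_F3 :
    Tendsto (fun τ : ℍ ↦ (degeneracyMap0 15 60 4 2 cuspFormEta15 τ - (4 * X ^ 4 : ℂ[X]).eval
      (Function.Periodic.qParam 1 (τ : ℂ))) / Function.Periodic.qParam 1 (τ : ℂ) ^ 7) atImInfty (𝓝 0) := by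
  obtain ⟨-, -, -, hE4, -, -⟩ := euler_truncations
  have hE12 := tendsto_eulerFn (δ := 12) (m := 7) (by norm_num)
  have hE20 := tendsto_eulerFn (δ := 20) (m := 7) (by norm_num)
  have hE60 := tendsto_eulerFn (δ := 60) (m := 7) (by norm_num)
  have hG := QRemainder.reduce (4 * X ^ 4) (-4 - 4 * X ^ 4 : ℂ[X]) (by simp only [map_ofNat]; ring)
    (QRemainder.const_mul 4 (QRemainder.qParam_pow_mul 4 (QRemainder.mul (QRemainder.mul (QRemainder.mul hE4 hE12) hE20) hE60)))
  refine hG.congr fun τ ↦ ?_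
  rw [degeneracyMap0_apply 4 (by norm_num) cuspFormEta15, f15_eq, qParam_tpD, eulerFn_tpD, eulerFn_tpD, eulerFn_tpD, eulerFn_tpD]
  norm_num
  ring

/-- **`F₄ = f₂₀ = q − 2q³ − q⁵ + 2q⁷ + o(q⁷)`** (as `ι₁f₂₀`). [cite: CremonaAlgorithms1997, Table 3 (20a)] -/
theorem tendsto_F4 :
    Tendsto (fun τ : ℍ ↦ (degeneracyMap0 20 60 1 2 cuspFormEtaProductTwenty τ - (X - 2 * X ^ 3 - X ^ 5 + 2 * X ^ 7 : ℂ[X]).eval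
      (Function.Periodic.qParam 1 (τ : ℂ))) / Function.Periodic.qParam 1 (τ : ℂ) ^ 7) atImInfty (𝓝 0) := by
  obtain ⟨-, hE2, -, -, -, -⟩ := euler_truncations
  have hE10 := tendsto_eulerFn (δ := 10) (m := 7) (by norm_num)
  have hG := QRemainder.reduce (X - 2 * X ^ 3 - X ^ 5 + 2 * X ^ 7) (X : ℂ[X]) (by ring)
    (QRemainder.qParam_pow_mul 1 (QRemainder.mul (QRemainder.pow hE2 2) (QRemainder.pow hE10 2)))
  refine hG.congr fun τ ↦ ?_
  rw [congr_fun (coe_degeneracyMap0_one 20 60 2 (by norm_num) cuspFormEtaProductTwenty) τ, EulerRemaindersTwenty.etaProductTwenty_eq]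
  ring

/-- **`F₅ = ι₃f₂₀ = 3f₂₀(3τ) = 3q³ + o(q⁷)`.** [cite: DiamondShurman2005, §5.6] -/
theorem tendsto_F5 :
    Tendsto (fun τ : ℍ ↦ (degeneracyMap0 20 60 3 2 cuspFormEtaProductTwenty τ - (3 * X ^ 3 : ℂ[X]).eval
      (Function.Periodic.qParam 1 (τ : ℂ))) / Function.Periodic.qParam 1 (τ : ℂ) ^ 7) atImInfty (𝓝 0) := by
  obtain ⟨-, -, -, -, -, hE6⟩ := euler_truncations
  have hE30 := tendsto_eulerFn (δ := 30) (m := 7) (by norm_num)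
  have hG := QRemainder.reduce (3 * X ^ 3) (-6 * X + 3 * X ^ 7 : ℂ[X]) (by simp only [map_ofNat]; ring)
    (QRemainder.const_mul 3 (QRemainder.qParam_pow_mul 3 (QRemainder.mul (QRemainder.pow hE6 2) (QRemainder.pow hE30 2))))
  refine hG.congr fun τ ↦ ?_
  rw [degeneracyMap0_apply 3 (by norm_num) cuspFormEtaProductTwenty, EulerRemaindersTwenty.etaProductTwenty_eq, qParam_tpD,
    eulerFn_tpD, eulerFn_tpD]
  norm_num
  ring

section B

variable (B : CuspForm (Gamma0 30) 2) (hB : ⇑B = etaQuotient 30 (expFn [(3, 1), (5, 1), (6, 1), (10, 1)]))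
include hB

/-- **`F₆ = b₃₀ = q − q⁴ − q⁶ − 2q⁷ + o(q⁷)`** (as `ι₁b₃₀`). [folklore] -/
theorem tendsto_F6 :
    Tendsto (fun τ : ℍ ↦ (degeneracyMap0 30 60 1 2 B τ - (X - X ^ 4 - X ^ 6 - 2 * X ^ 7 : ℂ[X]).eval
      (Function.Periodic.qParam 1 (τ : ℂ))) / Function.Periodic.qParam 1 (τ : ℂ) ^ 7) atImInfty (𝓝 0) := by
  obtain ⟨-, -, hE3, -, hE5, hE6⟩ := euler_truncations
  have hE10 := tendsto_eulerFn (δ := 10) (m := 7) (by norm_num)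
  have hG := QRemainder.reduce (X - X ^ 4 - X ^ 6 - 2 * X ^ 7) (X + X ^ 2 + 2 * X ^ 4 + X ^ 5 - X ^ 7 - X ^ 10 : ℂ[X]) (by ring)
    (QRemainder.qParam_pow_mul 1 (QRemainder.mul (QRemainder.mul (QRemainder.mul hE3 hE5) hE6) hE10))
  refine hG.congr fun τ ↦ ?_
  rw [congr_fun (coe_degeneracyMap0_one 30 60 2 (by norm_num) B) τ, hB, b30_eq]
  ring

/-- **`F₇ = ι₂b₃₀ = 2b₃₀(2τ) = 2q² + o(q⁷)`.** [cite: DiamondShurman2005, §5.6] -/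
theorem tendsto_F7 :
    Tendsto (fun τ : ℍ ↦ (degeneracyMap0 30 60 2 2 B τ - (2 * X ^ 2 : ℂ[X]).eval
      (Function.Periodic.qParam 1 (τ : ℂ))) / Function.Periodic.qParam 1 (τ : ℂ) ^ 7) atImInfty (𝓝 0) := by
  obtain ⟨-, -, -, -, -, hE6⟩ := euler_truncations
  have hE10 := tendsto_eulerFn (δ := 10) (m := 7) (by norm_num)
  have hE12 := tendsto_eulerFn (δ := 12) (m := 7) (by norm_num)
  have hE20 := tendsto_eulerFn (δ := 20) (m := 7) (by norm_num)
  have hG := QRemainder.reduce (2 * X ^ 2) (-2 : ℂ[X]) (by simp only [map_ofNat]; ring)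
    (QRemainder.const_mul 2 (QRemainder.qParam_pow_mul 2 (QRemainder.mul (QRemainder.mul (QRemainder.mul hE6 hE10) hE12) hE20)))
  refine hG.congr fun τ ↦ ?_
  rw [degeneracyMap0_apply 2 (by norm_num) B, hB, b30_eq, qParam_tpD, eulerFn_tpD, eulerFn_tpD, eulerFn_tpD, eulerFn_tpD]
  norm_num
  ring

end B

/-- **The coefficient table** (`n = 1, …, 7`) of the seven old forms. [cite: CremonaAlgorithms1997, Table 3] -/
theorem cuspCoeff_table (B : CuspForm (Gamma0 30) 2) (hB : ⇑B = etaQuotient 30 (expFn [(3, 1), (5, 1), (6, 1), (10, 1)])) :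
    (cuspCoeff (degeneracyMap0 15 60 1 2 cuspFormEta15) 1 = 1 ∧ cuspCoeff (degeneracyMap0 15 60 1 2 cuspFormEta15) 2 = -1 ∧
      cuspCoeff (degeneracyMap0 15 60 1 2 cuspFormEta15) 3 = -1 ∧ cuspCoeff (degeneracyMap0 15 60 1 2 cuspFormEta15) 4 = -1 ∧
      cuspCoeff (degeneracyMap0 15 60 1 2 cuspFormEta15) 5 = 1 ∧ cuspCoeff (degeneracyMap0 15 60 1 2 cuspFormEta15) 6 = 1 ∧
      cuspCoeff (degeneracyMap0 15 60 1 2 cuspFormEta15) 7 = 0) ∧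
    (cuspCoeff (degeneracyMap0 15 60 2 2 cuspFormEta15) 1 = 0 ∧ cuspCoeff (degeneracyMap0 15 60 2 2 cuspFormEta15) 2 = 2 ∧
      cuspCoeff (degeneracyMap0 15 60 2 2 cuspFormEta15) 3 = 0 ∧ cuspCoeff (degeneracyMap0 15 60 2 2 cuspFormEta15) 4 = -2 ∧
      cuspCoeff (degeneracyMap0 15 60 2 2 cuspFormEta15) 5 = 0 ∧ cuspCoeff (degeneracyMap0 15 60 2 2 cuspFormEta15) 6 = -2 ∧
      cuspCoeff (degeneracyMap0 15 60 2 2 cuspFormEta15) 7 = 0) ∧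
    (cuspCoeff (degeneracyMap0 15 60 4 2 cuspFormEta15) 1 = 0 ∧ cuspCoeff (degeneracyMap0 15 60 4 2 cuspFormEta15) 2 = 0 ∧
      cuspCoeff (degeneracyMap0 15 60 4 2 cuspFormEta15) 3 = 0 ∧ cuspCoeff (degeneracyMap0 15 60 4 2 cuspFormEta15) 4 = 4 ∧
      cuspCoeff (degeneracyMap0 15 60 4 2 cuspFormEta15) 5 = 0 ∧ cuspCoeff (degeneracyMap0 15 60 4 2 cuspFormEta15) 6 = 0 ∧
      cuspCoeff (degeneracyMap0 15 60 4 2 cuspFormEta15) 7 = 0) ∧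
    (cuspCoeff (degeneracyMap0 20 60 1 2 cuspFormEtaProductTwenty) 1 = 1 ∧ cuspCoeff (degeneracyMap0 20 60 1 2 cuspFormEtaProductTwenty) 2 = 0 ∧
      cuspCoeff (degeneracyMap0 20 60 1 2 cuspFormEtaProductTwenty) 3 = -2 ∧ cuspCoeff (degeneracyMap0 20 60 1 2 cuspFormEtaProductTwenty) 4 = 0 ∧
      cuspCoeff (degeneracyMap0 20 60 1 2 cuspFormEtaProductTwenty) 5 = -1 ∧ cuspCoeff (degeneracyMap0 20 60 1 2 cuspFormEtaProductTwenty) 6 = 0 ∧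
      cuspCoeff (degeneracyMap0 20 60 1 2 cuspFormEtaProductTwenty) 7 = 2) ∧
    (cuspCoeff (degeneracyMap0 20 60 3 2 cuspFormEtaProductTwenty) 1 = 0 ∧ cuspCoeff (degeneracyMap0 20 60 3 2 cuspFormEtaProductTwenty) 2 = 0 ∧
      cuspCoeff (degeneracyMap0 20 60 3 2 cuspFormEtaProductTwenty) 3 = 3 ∧ cuspCoeff (degeneracyMap0 20 60 3 2 cuspFormEtaProductTwenty) 4 = 0 ∧
      cuspCoeff (degeneracyMap0 20 60 3 2 cuspFormEtaProductTwenty) 5 = 0 ∧ cuspCoeff (degeneracyMap0 20 60 3 2 cuspFormEtaProductTwenty) 6 = 0 ∧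
      cuspCoeff (degeneracyMap0 20 60 3 2 cuspFormEtaProductTwenty) 7 = 0) ∧
    (cuspCoeff (degeneracyMap0 30 60 1 2 B) 1 = 1 ∧ cuspCoeff (degeneracyMap0 30 60 1 2 B) 2 = 0 ∧ cuspCoeff (degeneracyMap0 30 60 1 2 B) 3 = 0 ∧
      cuspCoeff (degeneracyMap0 30 60 1 2 B) 4 = -1 ∧ cuspCoeff (degeneracyMap0 30 60 1 2 B) 5 = 0 ∧ cuspCoeff (degeneracyMap0 30 60 1 2 B) 6 = -1 ∧
      cuspCoeff (degeneracyMap0 30 60 1 2 B) 7 = -2) ∧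
    (cuspCoeff (degeneracyMap0 30 60 2 2 B) 1 = 0 ∧ cuspCoeff (degeneracyMap0 30 60 2 2 B) 2 = 2 ∧ cuspCoeff (degeneracyMap0 30 60 2 2 B) 3 = 0 ∧
      cuspCoeff (degeneracyMap0 30 60 2 2 B) 4 = 0 ∧ cuspCoeff (degeneracyMap0 30 60 2 2 B) 5 = 0 ∧ cuspCoeff (degeneracyMap0 30 60 2 2 B) 6 = 0 ∧
      cuspCoeff (degeneracyMap0 30 60 2 2 B) 7 = 0) := by
  have h1 := fun n hn ↦ cuspCoeff_eq_coeff_of_tendsto _ _ 7 (by compute_degree!) tendsto_F1 n hn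
  have h2 := fun n hn ↦ cuspCoeff_eq_coeff_of_tendsto _ _ 7 (by compute_degree!) tendsto_F2 n hn
  have h3 := fun n hn ↦ cuspCoeff_eq_coeff_of_tendsto _ _ 7 (by compute_degree!) tendsto_F3 n hn
  have h4 := fun n hn ↦ cuspCoeff_eq_coeff_of_tendsto _ _ 7 (by compute_degree!) tendsto_F4 n hn
  have h5 := fun n hn ↦ cuspCoeff_eq_coeff_of_tendsto _ _ 7 (by compute_degree!) tendsto_F5 n hn
  have h6 := fun n hn ↦ cuspCoeff_eq_coeff_of_tendsto _ _ 7 (by compute_degree!) (tendsto_F6 B hB) n hn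
  have h7 := fun n hn ↦ cuspCoeff_eq_coeff_of_tendsto _ _ 7 (by compute_degree!) (tendsto_F7 B hB) n hn
  refine ⟨⟨?_, ?_, ?_, ?_, ?_, ?_, ?_⟩, ⟨?_, ?_, ?_, ?_, ?_, ?_, ?_⟩, ⟨?_, ?_, ?_, ?_, ?_, ?_, ?_⟩, ⟨?_, ?_, ?_, ?_, ?_, ?_, ?_⟩,
    ⟨?_, ?_, ?_, ?_, ?_, ?_, ?_⟩, ⟨?_, ?_, ?_, ?_, ?_, ?_, ?_⟩, ⟨?_, ?_, ?_, ?_, ?_, ?_, ?_⟩⟩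
  all_goals first
    | (rw [h1 _ (by norm_num)]; simp [coeff_X])
    | (rw [h2 _ (by norm_num)]; simp)
    | (rw [h3 _ (by norm_num)]; simp)
    | (rw [h4 _ (by norm_num)]; simp [coeff_X])
    | (rw [h5 _ (by norm_num)]; simp)
    | (rw [h6 _ (by norm_num)]; simp [coeff_X])
    | (rw [h7 _ (by norm_num)]; simp)

end Summit.BirchSwinnertonDyer.BirchSwinnertonDyer.Theorems.ManinLocalTwoThree.NoNewformSixty

end
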